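import Summits.NavierStokesRegularity.NavierStokesRegularity.Theorems.FilamentSkeletonRssCoreLinearInvertibilityClassClosureToolsB
import Literature.Analysis.FluidPDE.GaussianVortexPlanarProofs
import Literature.Analysis.FluidPDE.BiotSavart2DSymmetry
import Literature.Analysis.FluidPDE.WholeSpaceIBP

/-!
# Tools for stub `stub_gradientInClass` of crux `CoreLinearInvertibility`
# (stmt-NavierStokesRegularity-17973), line `Sketch`

(log: v1 — weight calculus, moments of `X_λ`, Schur bound for the Biot–Savart term; the sibling
tools files `…ClassClosureToolsA/B` are imported for `continuous_gaussWeightLam` and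
`integrable_norm_sq_mul_gaussWeightLam`.)
-/

set_option linter.dupNamespace false

noncomputable section

namespace Summit.NavierStokesRegularity.NavierStokesRegularity.Theorems

open MeasureTheory Filter Topology Set Metric
open Literature.Analysis.FluidPDE
open scoped InnerProductSpace Laplacian ContDiff Convolution ENNReal

/-! ### The weight `G_λ⁻¹` -/

/-- `G_λ⁻¹ = (4π/(1−λ)) e^{(1−λ)|x|²/4}`. [folklore] -/
theorem inv_gaussWeightLam_eq (lam : ℝ) (x : EuclideanSpace ℝ (Fin 2)) :
    (gaussWeightLam lam x)⁻¹ =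
      ((1 - lam) / (4 * Real.pi))⁻¹ * Real.exp ((1 - lam) / 4 * ‖x‖ ^ 2) := by
  rw [gaussWeightLam, mul_inv, Real.exp_neg, inv_inv]

/-- `G_λ⁻¹` is smooth. [folklore] -/
theorem contDiff_inv_gaussWeightLam (lam : ℝ) {n : WithTop ℕ∞} :
    ContDiff ℝ n fun x : EuclideanSpace ℝ (Fin 2) => (gaussWeightLam lam x)⁻¹ := by
  rw [show (fun x : EuclideanSpace ℝ (Fin 2) => (gaussWeightLam lam x)⁻¹) = fun x =>
      ((1 - lam) / (4 * Real.pi))⁻¹ * Real.exp ((1 - lam) / 4 * ‖x‖ ^ 2) from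
    funext (inv_gaussWeightLam_eq lam)]
  exact contDiff_const.mul (Real.contDiff_exp.comp (contDiff_const.mul (contDiff_norm_sq ℝ)))

/-- `D(G_λ⁻¹)(x)[v] = ((1−λ)/2) ⟪x, v⟫ G_λ⁻¹(x)`. [folklore] -/
theorem hasFDerivAt_inv_gaussWeightLam (lam : ℝ) (x : EuclideanSpace ℝ (Fin 2)) :
    HasFDerivAt (fun y : EuclideanSpace ℝ (Fin 2) => (gaussWeightLam lam y)⁻¹)
      (((1 - lam) / 2 * (gaussWeightLam lam x)⁻¹) • innerSL ℝ x) x := by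
  have h1 : HasFDerivAt (fun y : EuclideanSpace ℝ (Fin 2) => ‖y‖ ^ 2) (2 • innerSL ℝ x) x :=
    (hasStrictFDerivAt_norm_sq x).hasFDerivAt
  have h2 := ((h1.const_mul ((1 - lam) / 4)).exp).const_mul ((1 - lam) / (4 * Real.pi))⁻¹
  have heq : (fun y : EuclideanSpace ℝ (Fin 2) => (gaussWeightLam lam y)⁻¹) = fun y =>
      ((1 - lam) / (4 * Real.pi))⁻¹ * Real.exp ((1 - lam) / 4 * ‖y‖ ^ 2) :=
    funext (inv_gaussWeightLam_eq lam)
  rw [heq]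
  refine h2.congr_fderiv ?_
  ext v
  simp only [FunLike.coe_smul, Pi.smul_apply, innerSL_apply_apply]
  simp only [smul_eq_mul, nsmul_eq_mul, Nat.cast_ofNat]
  rw [inv_gaussWeightLam_eq]
  ring

/-- `∂ᵥ(G_λ⁻¹) = ((1−λ)/2) ⟪x, v⟫ G_λ⁻¹`. [folklore] -/
theorem fderiv_inv_gaussWeightLam_apply (lam : ℝ) (x v : EuclideanSpace ℝ (Fin 2)) :
    fderiv ℝ (fun y : EuclideanSpace ℝ (Fin 2) => (gaussWeightLam lam y)⁻¹) x v =
      (1 - lam) / 2 * ⟪x, v⟫_ℝ * (gaussWeightLam lam x)⁻¹ := by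
  rw [(hasFDerivAt_inv_gaussWeightLam lam x).fderiv]
  simp only [FunLike.coe_smul, Pi.smul_apply, innerSL_apply_apply, smul_eq_mul]
  ring

/-- `G/G_λ ≤ (1−λ)⁻¹` for `0 ≤ λ < 1` (`G/G_λ = (1−λ)⁻¹ e^{−λ|x|²/4}`). [folklore] -/
theorem inv_gaussWeightLam_mul_gaussVortexProfile_le {lam : ℝ} (hlam : lam ∈ Set.Ico (0 : ℝ) 1)
    (x : EuclideanSpace ℝ (Fin 2)) :
    (gaussWeightLam lam x)⁻¹ * gaussVortexProfile x ≤ (1 - lam)⁻¹ := by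
  obtain ⟨hl0, hl1⟩ := hlam
  have hq : 0 < 1 - lam := by linarith
  rw [inv_gaussWeightLam_eq, gaussVortexProfile]
  have hexp : Real.exp ((1 - lam) / 4 * ‖x‖ ^ 2) * Real.exp (-(‖x‖ ^ 2 / 4)) ≤ 1 := by
    rw [← Real.exp_add, Real.exp_le_one_iff]
    nlinarith [sq_nonneg ‖x‖]
  have hpi : 0 < Real.pi := Real.pi_pos
  calc ((1 - lam) / (4 * Real.pi))⁻¹ * Real.exp ((1 - lam) / 4 * ‖x‖ ^ 2) *
        ((4 * Real.pi)⁻¹ * Real.exp (-(‖x‖ ^ 2 / 4)))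
      = (1 - lam)⁻¹ * (Real.exp ((1 - lam) / 4 * ‖x‖ ^ 2) * Real.exp (-(‖x‖ ^ 2 / 4))) := by
        field_simp
    _ ≤ (1 - lam)⁻¹ * 1 := by gcongr
    _ = (1 - lam)⁻¹ := mul_one _

/-- `t e^{−at} ≤ a⁻¹` for `a > 0` (from `1 + s ≤ eˢ`). [folklore] -/
theorem mul_exp_neg_mul_le_inv {a : ℝ} (ha : 0 < a) (t : ℝ) :
    t * Real.exp (-(a * t)) ≤ a⁻¹ := by
  have h1 : a * t ≤ Real.exp (a * t) := by
    have := Real.add_one_le_exp (a * t); linarith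
  have hE := Real.exp_pos (-(a * t))
  have h2 : a * t * Real.exp (-(a * t)) ≤ 1 := by
    have h := mul_le_mul_of_nonneg_right h1 hE.le
    rwa [← Real.exp_add, add_neg_cancel, Real.exp_zero] at h
  calc t * Real.exp (-(a * t)) = a⁻¹ * (a * t * Real.exp (-(a * t))) := by
        field_simp
    _ ≤ a⁻¹ * 1 := by gcongr
    _ = a⁻¹ := mul_one _

/-! ### Moments of functions in `X_λ = L²(G_λ⁻¹ dx)` -/

/-- `‖x‖² G_λ(x) ≤ π⁻¹` for `λ < 1`. [folklore] -/
theorem norm_sq_mul_gaussWeightLam_le_inv_pi {lam : ℝ} (hlam : lam < 1)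
    (x : EuclideanSpace ℝ (Fin 2)) :
    ‖x‖ ^ 2 * gaussWeightLam lam x ≤ Real.pi⁻¹ := by
  have hq : 0 < 1 - lam := by linarith
  have ha : 0 < (1 - lam) / 4 := by positivity
  have key := mul_exp_neg_mul_le_inv ha (‖x‖ ^ 2)
  have hpi : 0 < Real.pi := Real.pi_pos
  rw [gaussWeightLam]
  calc ‖x‖ ^ 2 * ((1 - lam) / (4 * Real.pi) * Real.exp (-((1 - lam) / 4 * ‖x‖ ^ 2)))
      = (1 - lam) / (4 * Real.pi) * (‖x‖ ^ 2 * Real.exp (-((1 - lam) / 4 * ‖x‖ ^ 2))) := by ring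
    _ ≤ (1 - lam) / (4 * Real.pi) * ((1 - lam) / 4)⁻¹ := by gcongr
    _ = Real.pi⁻¹ := by field_simp

section Moments

variable {lam : ℝ} (hlam : lam < 1) {w : EuclideanSpace ℝ (Fin 2) → ℝ} (hwm : AEStronglyMeasurable
    w volume)
  (hX : Integrable fun x => (gaussWeightLam lam x)⁻¹ * w x ^ 2)
include hlam hwm hX

omit hlam in
/-- `X_λ ⊆ L²(∞;λ)` (the same space, two spellings). [folklore] -/
theorem memL2InftyLam_of_integrable_inv_mul_sq : MemL2InftyLam lam w :=
  ⟨hwm, hX.congr (Eventually.of_forall fun x => by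
    show (gaussWeightLam lam x)⁻¹ * w x ^ 2 = w x ^ 2 / gaussWeightLam lam x
    rw [div_eq_inv_mul])⟩

/-- `X_λ ⊆ L¹`. [folklore] -/
theorem integrable_of_integrable_inv_gaussWeightLam_mul_sq : Integrable w :=
  (memL2InftyLam_of_integrable_inv_mul_sq hwm hX).integrable hlam

/-- `X_λ ⊆ L²`. [folklore] -/
theorem integrable_sq_of_integrable_inv_gaussWeightLam_mul_sq : Integrable fun x => w x ^ 2 :=
  (memL2InftyLam_of_integrable_inv_mul_sq hwm hX).integrable_sq hlam

/-- First moment: `‖x‖ w ∈ L¹` for `w ∈ X_λ` (`2‖x‖|w| ≤ ‖x‖²G_λ + G_λ⁻¹w²`). [folklore] -/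
theorem integrable_norm_mul_of_integrable_inv_gaussWeightLam_mul_sq :
    Integrable fun x : EuclideanSpace ℝ (Fin 2) => ‖x‖ * w x := by
  refine Integrable.mono' (((integrable_norm_sq_mul_gaussWeightLam hlam).add hX).div_const 2)
    (continuous_norm.aestronglyMeasurable.mul hwm) (Eventually.of_forall fun x => ?_)
  have hG := gaussWeightLam_pos hlam x
  rw [norm_mul, norm_norm, Real.norm_eq_abs]
  simp only [Pi.add_apply]
  have key : ‖x‖ ^ 2 * gaussWeightLam lam x + (gaussWeightLam lam x)⁻¹ * w x ^ 2 -
      2 * (‖x‖ * |w x|) = (gaussWeightLam lam x)⁻¹ * (‖x‖ * gaussWeightLam lam x - |w x|) ^ 2 := by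
    rw [sub_sq, sq_abs]
    field_simp
    ring
  nlinarith [mul_nonneg (inv_nonneg.2 hG.le) (sq_nonneg (‖x‖ * gaussWeightLam lam x - |w x|))]

/-- Second moment: `‖x‖² w² ∈ L¹` for `w ∈ X_λ` (`‖x‖² w² = (‖x‖²G_λ)(G_λ⁻¹w²) ≤ π⁻¹ G_λ⁻¹w²`).
[folklore] -/
theorem integrable_norm_sq_mul_sq_of_integrable_inv_gaussWeightLam_mul_sq :
    Integrable fun x : EuclideanSpace ℝ (Fin 2) => ‖x‖ ^ 2 * w x ^ 2 := by
  refine Integrable.mono' (hX.const_mul Real.pi⁻¹)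
    ((continuous_norm.pow 2).aestronglyMeasurable.mul (hwm.pow 2))
    (Eventually.of_forall fun x => ?_)
  have hG := gaussWeightLam_pos hlam x
  rw [Real.norm_of_nonneg (by positivity)]
  calc ‖x‖ ^ 2 * w x ^ 2
      = ‖x‖ ^ 2 * gaussWeightLam lam x * ((gaussWeightLam lam x)⁻¹ * w x ^ 2) := by
        field_simp
    _ ≤ Real.pi⁻¹ * ((gaussWeightLam lam x)⁻¹ * w x ^ 2) :=
        mul_le_mul_of_nonneg_right (norm_sq_mul_gaussWeightLam_le_inv_pi hlam x) (by positivity)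

end Moments

/-! ### A Schur bound for the Biot–Savart velocity of an `X_λ` vorticity -/

/-- **Schur bound.** If `w`, `‖x‖w`, `w²`, `‖x‖²w²` are integrable and the Biot–Savart integrals of
`w` converge absolutely, then `x ↦ ‖x‖ |w(x)| ‖(K∗w)(x)‖` is integrable: with
`k(z) = (2π‖z‖)⁻¹ ≤ (2π)⁻¹(𝟙_{‖z‖<1}‖z‖⁻¹ + 1)`, the far part is `≤ (2π)⁻¹‖x‖|w(x)| ‖w‖₁` and the
near part is `≤ (4π)⁻¹(‖x‖²w(x)² ‖𝟙‖·‖⁻¹‖₁ + (w² ∗ 𝟙‖·‖⁻¹)(x))` by `2ab ≤ a² + b²` (Young).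
[folklore] -/
theorem integrable_norm_mul_abs_mul_norm_biotSavart2D {w : EuclideanSpace ℝ (Fin 2) → ℝ}
    (hwm : Measurable w) (h1 : Integrable w)
    (h2 : Integrable fun x : EuclideanSpace ℝ (Fin 2) => ‖x‖ * w x)
    (h3 : Integrable fun x => w x ^ 2)
    (h4 : Integrable fun x : EuclideanSpace ℝ (Fin 2) => ‖x‖ ^ 2 * w x ^ 2)
    (hK : ∀ x, Integrable fun y => w y • biotSavartKernel2D (x - y)) :
    Integrable fun x : EuclideanSpace ℝ (Fin 2) => ‖x‖ * |w x| * ‖biotSavart2D w x‖ := by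
  have hwa : AEStronglyMeasurable w volume := hwm.aestronglyMeasurable
  set κ : EuclideanSpace ℝ (Fin 2) → ℝ := indicator (ball 0 1) fun z => ‖z‖⁻¹ with hκ_def
  have hκi : Integrable κ := integrable_indicator_inv_norm
  have hκ0 : ∀ z, 0 ≤ κ z := indicator_inv_norm_nonneg
  have hκm : Measurable κ := measurable_norm.inv.indicator measurableSet_ball
  have hκle : ∀ z : EuclideanSpace ℝ (Fin 2), κ z ≤ ‖z‖⁻¹ := fun z =>
    indicator_le_self' (fun _ _ => inv_nonneg.2 (norm_nonneg _)) z
  have hker : ∀ z : EuclideanSpace ℝ (Fin 2), ‖z‖⁻¹ ≤ κ z + 1 := by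
    intro z
    by_cases hz : z ∈ ball (0 : EuclideanSpace ℝ (Fin 2)) 1
    · rw [hκ_def, indicator_of_mem hz]; linarith
    · rw [hκ_def, indicator_of_notMem hz, zero_add]
      rw [mem_ball_zero_iff, not_lt] at hz
      exact inv_le_one_of_one_le₀ hz
  -- the convolution `w² ∗ κ` is integrable and exists a.e.
  have hconv : Integrable fun x => ∫ t, w t ^ 2 * κ (x - t) :=
    h3.integrable_convolution (ContinuousLinearMap.mul ℝ ℝ) hκi
  have hae : ∀ᵐ x : EuclideanSpace ℝ (Fin 2), Integrable fun t => w t ^ 2 * κ (x - t) := by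
    filter_upwards [h3.ae_convolution_exists (ContinuousLinearMap.mul ℝ ℝ) hκi] with x hx
    exact hx
  set I₁ : ℝ := ∫ y, |w y| with hI₁
  set Iκ : ℝ := ∫ z, κ z with hIκ
  -- integrability of the near integrand at every point
  have hnear : ∀ x, Integrable fun y => |w y| * κ (x - y) := by
    intro x
    refine Integrable.mono' ((hK x).norm.const_mul (2 * Real.pi))
      ((continuous_abs.comp_aestronglyMeasurable hwa).mul
        (hκm.comp (measurable_const.sub measurable_id)).aestronglyMeasurable)
      (Eventually.of_forall fun y => ?_)
    rw [Real.norm_of_nonneg (mul_nonneg (abs_nonneg _) (hκ0 _)), norm_smul, Real.norm_eq_abs,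
      norm_biotSavartKernel2D]
    have hpi : 0 < Real.pi := Real.pi_pos
    calc |w y| * κ (x - y) ≤ |w y| * ‖x - y‖⁻¹ := by gcongr; exact hκle _
      _ = 2 * Real.pi * (|w y| * ((2 * Real.pi)⁻¹ * ‖x - y‖⁻¹)) := by field_simp
  have hBS : ∀ x, ‖biotSavart2D w x‖ ≤ (2 * Real.pi)⁻¹ * ((∫ y, |w y| * κ (x - y)) + I₁) := by
    intro x
    have heq : ∀ y, ‖w y • biotSavartKernel2D (x - y)‖ = (2 * Real.pi)⁻¹ * (|w y| * ‖x - y‖⁻¹) := by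
      intro y; rw [norm_smul, norm_biotSavartKernel2D, Real.norm_eq_abs]; ring
    have hi1 : Integrable fun y => (2 * Real.pi)⁻¹ * (|w y| * ‖x - y‖⁻¹) :=
      (hK x).norm.congr (Eventually.of_forall heq)
    have hi2 : Integrable fun y => (2 * Real.pi)⁻¹ * (|w y| * κ (x - y) + |w y|) :=
      ((hnear x).add h1.abs).const_mul _
    unfold biotSavart2D
    calc ‖∫ y, w y • biotSavartKernel2D (x - y)‖
        ≤ ∫ y, ‖w y • biotSavartKernel2D (x - y)‖ := norm_integral_le_integral_norm _
      _ = ∫ y, (2 * Real.pi)⁻¹ * (|w y| * ‖x - y‖⁻¹) := integral_congr_ae (Eventually.of_forall heq)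
      _ ≤ ∫ y, (2 * Real.pi)⁻¹ * (|w y| * κ (x - y) + |w y|) := by
        refine integral_mono hi1 hi2 fun y => ?_
        have h := hker (x - y)
        have h0 : 0 ≤ |w y| := abs_nonneg _
        have hpi : 0 ≤ (2 * Real.pi)⁻¹ := by positivity
        apply mul_le_mul_of_nonneg_left _ hpi
        nlinarith
      _ = (2 * Real.pi)⁻¹ * ((∫ y, |w y| * κ (x - y)) + I₁) := by
        rw [integral_const_mul, integral_add (hnear x) h1.abs]
  -- domination
  refine Integrable.mono'
    ((((h4.const_mul (Iκ / 2)).add (hconv.div_const 2)).add (h2.norm.const_mul I₁)).const_mul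
      (2 * Real.pi)⁻¹)
    (((continuous_norm.aestronglyMeasurable.mul (continuous_abs.comp_aestronglyMeasurable hwa))).mul
      (stronglyMeasurable_biotSavart2D hwm).aestronglyMeasurable.norm) ?_
  filter_upwards [hae] with x hx
  have hxw : 0 ≤ ‖x‖ * |w x| := by positivity
  rw [Real.norm_of_nonneg (by positivity)]
  simp only [Pi.add_apply]
  have hlow : Integrable fun y => ‖x‖ * |w x| * (|w y| * κ (x - y)) := (hnear x).const_mul _
  have hup : Integrable fun y => (‖x‖ ^ 2 * w x ^ 2 * κ (x - y) + w y ^ 2 * κ (x - y)) / 2 :=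
    (((hκi.comp_sub_left x).const_mul _).add hx).div_const 2
  have hmono : ∫ y, ‖x‖ * |w x| * (|w y| * κ (x - y)) ≤
      ∫ y, (‖x‖ ^ 2 * w x ^ 2 * κ (x - y) + w y ^ 2 * κ (x - y)) / 2 := by
    refine integral_mono hlow hup fun y => ?_
    have hk := hκ0 (x - y)
    have hsq : 2 * (‖x‖ * |w x|) * |w y| ≤ ‖x‖ ^ 2 * w x ^ 2 + w y ^ 2 := by
      nlinarith [sq_nonneg (‖x‖ * |w x| - |w y|), sq_abs (w x), sq_abs (w y)]
    show ‖x‖ * |w x| * (|w y| * κ (x - y)) ≤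
      (‖x‖ ^ 2 * w x ^ 2 * κ (x - y) + w y ^ 2 * κ (x - y)) / 2
    nlinarith [mul_le_mul_of_nonneg_right hsq hk]
  have hsplit : ∫ y, (‖x‖ ^ 2 * w x ^ 2 * κ (x - y) + w y ^ 2 * κ (x - y)) / 2 =
      (Iκ * (‖x‖ ^ 2 * w x ^ 2) + ∫ y, w y ^ 2 * κ (x - y)) / 2 := by
    rw [integral_div, integral_add ((hκi.comp_sub_left x).const_mul _) hx, integral_const_mul,
      integral_sub_left_eq_self κ volume x]
    ring
  calc ‖x‖ * |w x| * ‖biotSavart2D w x‖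
      ≤ ‖x‖ * |w x| * ((2 * Real.pi)⁻¹ * ((∫ y, |w y| * κ (x - y)) + I₁)) :=
        mul_le_mul_of_nonneg_left (hBS x) hxw
    _ = (2 * Real.pi)⁻¹ * ((∫ y, ‖x‖ * |w x| * (|w y| * κ (x - y))) + I₁ * (‖x‖ * |w x|)) := by
        rw [integral_const_mul]; ring
    _ ≤ (2 * Real.pi)⁻¹ * ((Iκ * (‖x‖ ^ 2 * w x ^ 2) + ∫ y, w y ^ 2 * κ (x - y)) / 2 +
          I₁ * (‖x‖ * |w x|)) := by
        rw [← hsplit]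
        have hpi : 0 ≤ (2 * Real.pi)⁻¹ := by positivity
        gcongr
    _ = (2 * Real.pi)⁻¹ * (Iκ / 2 * (‖x‖ ^ 2 * w x ^ 2) + (∫ y, w y ^ 2 * κ (x - y)) / 2 +
          I₁ * ‖‖x‖ * w x‖) := by
        rw [norm_mul, norm_norm, Real.norm_eq_abs]; ring

/-- **The nonlocal pairing density is integrable.** For continuous `w ∈ X_λ` (`0 ≤ λ < 1`) with
absolutely convergent Biot–Savart integrals, `G_λ⁻¹ |⟪K∗w, ∇G⟫| |w| ∈ L¹(ℝ²)`:
`‖∇G(x)‖ = (G(x)/2)‖x‖`, `G/G_λ ≤ (1−λ)⁻¹`, and the Schur bound. [folklore] -/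
theorem integrable_inv_gaussWeightLam_mul_abs_inner_biotSavart2D_mul {lam : ℝ}
    (hlam : lam ∈ Set.Ico (0 : ℝ) 1) {w : EuclideanSpace ℝ (Fin 2) → ℝ} (hw : Continuous w)
    (hX : Integrable fun x => (gaussWeightLam lam x)⁻¹ * w x ^ 2)
    (hK : ∀ x, Integrable fun y => w y • biotSavartKernel2D (x - y)) :
    Integrable fun x => (gaussWeightLam lam x)⁻¹ *
      (|⟪biotSavart2D w x, gradient gaussVortexProfile x⟫_ℝ| * |w x|) := by
  have hl1 : lam < 1 := hlam.2
  have hwa : AEStronglyMeasurable w volume := hw.aestronglyMeasurable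
  have hH := integrable_norm_mul_abs_mul_norm_biotSavart2D hw.measurable
    (integrable_of_integrable_inv_gaussWeightLam_mul_sq hl1 hwa hX)
    (integrable_norm_mul_of_integrable_inv_gaussWeightLam_mul_sq hl1 hwa hX)
    (integrable_sq_of_integrable_inv_gaussWeightLam_mul_sq hl1 hwa hX)
    (integrable_norm_sq_mul_sq_of_integrable_inv_gaussWeightLam_mul_sq hl1 hwa hX) hK
  have hgrad : ∀ x : EuclideanSpace ℝ (Fin 2),
      ‖gradient gaussVortexProfile x‖ ≤ gaussVortexProfile x / 2 * ‖x‖ := by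
    intro x
    rw [gradient, LinearIsometryEquiv.norm_map]
    refine ContinuousLinearMap.opNorm_le_bound _ (by positivity [gaussVortexProfile_pos x]) ?_
    intro v
    rw [fderiv_gaussVortexProfile_apply, norm_mul, norm_neg, Real.norm_of_nonneg
      (by positivity [gaussVortexProfile_pos x])]
    calc gaussVortexProfile x / 2 * ‖⟪x, v⟫_ℝ‖ ≤ gaussVortexProfile x / 2 * (‖x‖ * ‖v‖) := by
          gcongr
          · exact (div_pos (gaussVortexProfile_pos x) two_pos).le
          · exact norm_inner_le_norm x v
      _ = gaussVortexProfile x / 2 * ‖x‖ * ‖v‖ := by ring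
  refine Integrable.mono' (hH.const_mul ((1 - lam)⁻¹ / 2))
    ((continuous_gaussWeightLam lam).inv₀ (fun x => (gaussWeightLam_pos hl1 x).ne')
      |>.aestronglyMeasurable.mul
      ((continuous_abs.comp_aestronglyMeasurable
        ((stronglyMeasurable_biotSavart2D hw.measurable).aestronglyMeasurable.inner
          (continuous_gradient_of_contDiff (contDiff_gaussVortexProfile (n := 1))
            |>.aestronglyMeasurable))).mul (continuous_abs.comp_aestronglyMeasurable hwa)))
    (Eventually.of_forall fun x => ?_)
  have hG := gaussWeightLam_pos hl1 x
  have hGG := gaussVortexProfile_pos x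
  have hratio := inv_gaussWeightLam_mul_gaussVortexProfile_le hlam x
  rw [Real.norm_of_nonneg (by positivity)]
  have hN : |⟪biotSavart2D w x, gradient gaussVortexProfile x⟫_ℝ| ≤
      ‖biotSavart2D w x‖ * (gaussVortexProfile x / 2 * ‖x‖) :=
    (abs_real_inner_le_norm _ _).trans (mul_le_mul_of_nonneg_left (hgrad x) (norm_nonneg _))
  calc (gaussWeightLam lam x)⁻¹ * (|⟪biotSavart2D w x, gradient gaussVortexProfile x⟫_ℝ| * |w x|)
      ≤ (gaussWeightLam lam x)⁻¹ *
          (‖biotSavart2D w x‖ * (gaussVortexProfile x / 2 * ‖x‖) * |w x|) := by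
        gcongr
    _ = (gaussWeightLam lam x)⁻¹ * gaussVortexProfile x / 2 *
          (‖x‖ * |w x| * ‖biotSavart2D w x‖) := by ring
    _ ≤ (1 - lam)⁻¹ / 2 * (‖x‖ * |w x| * ‖biotSavart2D w x‖) := by
        gcongr

/-- Registered tools stub of crux stmt-NavierStokesRegularity-17973 (`stub_gradientInClassTools`):
the derivative of the weight `G_λ⁻¹` and the integrability of the nonlocal pairing density
`G_λ⁻¹|⟪K∗w, ∇G⟫||w|` on the crux class. [folklore] -/
theorem stub_gradientInClassTools :
    (∀ (lam : ℝ) (x v : EuclideanSpace ℝ (Fin 2)),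
      fderiv ℝ (fun y => (gaussWeightLam lam y)⁻¹) x v =
        (1 - lam) / 2 * ⟪x, v⟫_ℝ * (gaussWeightLam lam x)⁻¹) ∧
    (∀ lam ∈ Set.Ico (0 : ℝ) 1, ∀ w : EuclideanSpace ℝ (Fin 2) → ℝ, Continuous w →
      Integrable (fun x => (gaussWeightLam lam x)⁻¹ * w x ^ 2) →
      (∀ x, Integrable (fun y => w y • biotSavartKernel2D (x - y))) →
      Integrable (fun x => (gaussWeightLam lam x)⁻¹ *
        (|⟪biotSavart2D w x, gradient gaussVortexProfile x⟫_ℝ| * |w x|))) :=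
  ⟨fderiv_inv_gaussWeightLam_apply,
    fun _ hlam _ hw hX hK =>
      integrable_inv_gaussWeightLam_mul_abs_inner_biotSavart2D_mul hlam hw hX hK⟩

end Summit.NavierStokesRegularity.NavierStokesRegularity.Theorems
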